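import Literature.Topology.FourManifolds.TubeStage
import HarnessLib

/-!
# The tube stage map is a local diffeomorphism

Topic `Literature/Topology/FourManifolds`; sequel of `TubeStage.lean` (codimension `≥ 2` step of the
smoothing of PD homeomorphisms: Munkres, Ann. of Math. 72 (1960), §§4–5; Campbell–D'Onofrio–Vítek,
J. Geom. Anal. (2026), Lemmas 3.2, 3.4).  We prove that the assembled stage map
`tubeStageMap r ρ T N Ψ λ` has an invertible derivative at every point of `V × B(0, r)`
(`exists_hasFDerivAt_equiv_tubeStageMap`), zone by zone, from the POINTWISE nondegeneracy criteria
of the zone files (`TubeFlatten`, `TubeConeify`, `TubeRound`, `TubeRadial`) and local agreement on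
the overlap annuli.  The hypotheses are exactly the pointwise, inverse-free conditions of the
smoothing induction: fibre-injectivity and a `K₀`-small source-form Euler defect of `N` on the
shell `r/4 ≤ t ≤ r/2`, radial transversality and `ρ ≤ ‖V‖` on the sphere bundle `t = r/4`, the
flatten coupling on `5r/8 ≤ t ≤ r`, and the unit-family nondegeneracy below `r/8`; the two
universal constants entering them (`K₀` bounding the pacing exponent, `C₁/r` bounding the flatten
cutoff's derivative) are shown to exist once and for all by scaling (`exists_stageExponentConst`,
`exists_deriv_flattenCutoff_bound`).  Everything is proved; no definitions besides those of
`TubeStage.lean`; no named facts.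

## References

* J. R. Munkres, *Obstructions to the smoothing of piecewise-differentiable homeomorphisms*, Ann.
  of Math. (2) 72 (1960), 521–554, §§4–5. [Munkres1960]
* D. Campbell, L. D'Onofrio, T. Vítek, *Diffeomorphic approximation of piecewise affine
  homeomorphisms*, J. Geom. Anal. 36 (2026), Lemmas 3.2, 3.4. [CampbellDonofrioVitek2026]
-/

noncomputable section

open Set Function Metric Filter Real
open scoped Topology ContDiff RealInnerProductSpace

namespace Literature.Topology.FourManifolds

/-! ### §1 Scaling of the cutoffs and the two universal constants -/

section Scaling

/-- Ramp cutoffs are scale invariant: `rampCutoff (c a) (c b) (c t) = rampCutoff a b t`, `c ≠ 0`.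
[folklore] -/
theorem rampCutoff_scale {a b c : ℝ} (hc : c ≠ 0) (t : ℝ) :
    rampCutoff (c * a) (c * b) (c * t) = rampCutoff a b t := by
  unfold rampCutoff
  congr 1
  rw [← mul_sub, ← mul_sub, mul_div_mul_left _ _ hc]

/-- The flatten cutoff of radius `r` is the unit one read at `t/r`. [folklore] -/
theorem flattenCutoff_scale {r : ℝ} (hr : 0 < r) (t : ℝ) : flattenCutoff r t = flattenCutoff 1 (t / r) := by
  have h := rampCutoff_scale (a := 5 * 1 / 8) (b := 7 * 1 / 8) hr.ne' (t / r)
  rw [mul_div_cancel₀ _ hr.ne'] at h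
  rw [flattenCutoff, flattenCutoff, ← h]
  congr 1 <;> ring

/-- The stage pacing of radius `r` is `r` times the unit one read at `t/r`. [folklore] -/
theorem stagePacing_scale {r : ℝ} (hr : 0 < r) (t : ℝ) : stagePacing r t = r * stagePacing 1 (t / r) := by
  have h := rampCutoff_scale (a := 5 * 1 / 16) (b := 7 * 1 / 16) hr.ne' (t / r)
  rw [mul_div_cancel₀ _ hr.ne'] at h
  simp only [stagePacing, conePacing]
  rw [show (5 * r / 16 : ℝ) = r * (5 * 1 / 16) by ring, show (7 * r / 16 : ℝ) = r * (7 * 1 / 16) by ring, h]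
  field_simp

/-- Derivative of the flatten cutoff under scaling. [folklore] -/
theorem deriv_flattenCutoff_scale {r : ℝ} (hr : 0 < r) (t : ℝ) :
    deriv (flattenCutoff r) t = deriv (flattenCutoff 1) (t / r) / r := by
  have hfun : flattenCutoff r = fun s => flattenCutoff 1 (s / r) := funext (flattenCutoff_scale hr)
  have hd : HasDerivAt (fun s => flattenCutoff 1 (s / r)) (deriv (flattenCutoff 1) (t / r) * (1 / r)) t := by
    have h1 : HasDerivAt (flattenCutoff 1) (deriv (flattenCutoff 1) (t / r)) (t / r) :=
      (((contDiff_flattenCutoff 1).differentiable (by simp)) _).hasDerivAt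
    exact h1.comp t ((hasDerivAt_id t).div_const r)
  rw [hfun, hd.deriv]
  ring

/-- Derivative of the stage pacing under scaling. [folklore] -/
theorem deriv_stagePacing_scale {r : ℝ} (hr : 0 < r) (t : ℝ) :
    deriv (stagePacing r) t = deriv (stagePacing 1) (t / r) := by
  have hfun : stagePacing r = fun s => r * stagePacing 1 (s / r) := funext (stagePacing_scale hr)
  have hd : HasDerivAt (fun s => r * stagePacing 1 (s / r))
      (r * (deriv (stagePacing 1) (t / r) * (1 / r))) t := by
    have h1 : HasDerivAt (stagePacing 1) (deriv (stagePacing 1) (t / r)) (t / r) :=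
      (((contDiff_stagePacing 1).differentiable (by simp)) _).hasDerivAt
    exact (h1.comp t ((hasDerivAt_id t).div_const r)).const_mul r
  rw [hfun, hd.deriv]
  field_simp

/-- **A universal bound for the derivative of the flatten cutoff**: `|η'| ≤ C₁ / r`. [folklore] -/
theorem exists_deriv_flattenCutoff_bound :
    ∃ C₁ : ℝ, 0 ≤ C₁ ∧ ∀ r : ℝ, 0 < r → ∀ t : ℝ, |deriv (flattenCutoff r) t| ≤ C₁ / r := by
  obtain ⟨C, hC0, hC⟩ := exists_deriv_rampCutoff_bound (a := 5 * 1 / 8) (b := 7 * 1 / 8) (by norm_num)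
  refine ⟨C / (7 * 1 / 8 - 5 * 1 / 8), div_nonneg hC0 (by norm_num), fun r hr t => ?_⟩
  rw [deriv_flattenCutoff_scale hr, abs_div, abs_of_pos hr]
  refine div_le_div_of_nonneg_right ?_ hr.le
  have h := hC (t / r)
  change |deriv (rampCutoff (5 * 1 / 8) (7 * 1 / 8)) (t / r)| ≤ _
  rw [abs_of_nonneg h.1]
  exact h.2

/-- **A universal bound for the exponent of the stage pacing** on `0 < t ≤ r/2`:
`|1 − t μ'(t)/μ(t)| ≤ K₀` (the hypothesis `hκ` of `injective_fderiv_coneifyStageMap`). [folklore] -/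
theorem exists_stageExponentConst :
    ∃ K₀ : ℝ, 1 ≤ K₀ ∧ ∀ r : ℝ, 0 < r → ∀ t : ℝ, 0 < t → t ≤ r / 2 →
      |1 - t * deriv (stagePacing r) t / stagePacing r t| ≤ K₀ := by
  obtain ⟨K₀, hK₀, hK⟩ := abs_one_sub_exponent_conePacing_le (r₁ := 1 / 4) (a := 5 * 1 / 16)
    (b := 7 * 1 / 16) (by norm_num) (by norm_num) (by norm_num)
  refine ⟨K₀, hK₀, fun r hr t ht0 htr => ?_⟩
  rcases lt_or_ge t (5 * r / 16) with h1 | h1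
  · -- the pacing is locally the constant `r/4`
    have hd : deriv (stagePacing r) t = 0 := by
      have hev : stagePacing r =ᶠ[𝓝 t] fun _ => r / 4 := by
        filter_upwards [Iio_mem_nhds h1] with s hs
        exact stagePacing_of_le hr (le_of_lt hs)
      rw [hev.deriv_eq]; exact deriv_const t _
    rw [hd, mul_zero, zero_div, sub_zero, abs_one]; exact hK₀
  rcases le_or_gt t (7 * r / 16) with h2 | h2
  · -- scale to `r = 1`
    have hμ : stagePacing r t = r * stagePacing 1 (t / r) := stagePacing_scale hr t
    have hμ1 : 0 < stagePacing 1 (t / r) := by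
      have := stagePacing_pos (r := 1) one_pos (t := t / r) (by rw [le_div_iff₀ hr]; linarith)
      simpa using this
    rw [deriv_stagePacing_scale hr, hμ]
    have key : 1 - t * deriv (stagePacing 1) (t / r) / (r * stagePacing 1 (t / r)) =
        1 - (t / r) * deriv (stagePacing 1) (t / r) / stagePacing 1 (t / r) := by
      field_simp
    rw [key]
    refine hK (t / r) ?_ ?_
    · rw [le_div_iff₀ hr]; linarith
    · rw [div_le_iff₀ hr]; linarith
  · -- the pacing is locally the identity
    have hev : stagePacing r =ᶠ[𝓝 t] fun s => s := by
      filter_upwards [Ioi_mem_nhds h2] with s hs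
      exact stagePacing_of_ge hr (le_of_lt hs)
    have hd : deriv (stagePacing r) t = 1 := by rw [hev.deriv_eq]; exact deriv_id t
    rw [hd, hev.self_of_nhds, mul_one, div_self ht0.ne', sub_self, abs_zero]
    linarith

/-- The round cutoff has nonnegative derivative. [folklore] -/
theorem deriv_roundCutoff_nonneg {r : ℝ} (hr : 0 < r) (t : ℝ) : 0 ≤ deriv (roundCutoff r) t := by
  obtain ⟨C, -, hC⟩ := exists_deriv_rampCutoff_bound (a := 5 * r / 32) (b := 7 * r / 32) (by linarith)
  exact (hC t).1

end Scaling

/-! ### §2 The graph of the normal part -/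

section Graph

variable {E : Type*} [NormedAddCommGroup E] [NormedSpace ℝ E]
variable {F : Type*} [NormedAddCommGroup F] [InnerProductSpace ℝ F]

/-- `∞ ≠ 0` (bookkeeping). [folklore] -/
private theorem sd_infty_ne_zero : (∞ : WithTop ℕ∞) ≠ 0 := by
  simp

/-- **The graph map `(x, y) ↦ (x, N (x, y))` has invertible derivative where the fibre
derivative of `N` is injective** (finite dimensions). [folklore] -/
theorem exists_hasFDerivAt_equiv_graph [FiniteDimensional ℝ E] [FiniteDimensional ℝ F]
    {N : E × F → F} {p : E × F} (hN : ContDiffAt ℝ ∞ N p)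
    (hinj : ∀ w : F, fderiv ℝ N p (0, w) = 0 → w = 0) :
    ∃ L : (E × F) ≃L[ℝ] E × F,
      HasFDerivAt (fun q : E × F => (q.1, N q)) (L : E × F →L[ℝ] E × F) p := by
  have hd : HasFDerivAt (fun q : E × F => (q.1, N q))
      ((ContinuousLinearMap.fst ℝ E F).prod (fderiv ℝ N p)) p :=
    hasFDerivAt_fst.prodMk (hN.differentiableAt sd_infty_ne_zero).hasFDerivAt
  have hinj' : Injective ((ContinuousLinearMap.fst ℝ E F).prod (fderiv ℝ N p)) := by
    refine (injective_iff_map_eq_zero _).2 fun vw h => ?_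
    obtain ⟨v, w⟩ := vw
    have h1 := congrArg Prod.fst h
    have h2 := congrArg Prod.snd h
    simp only [ContinuousLinearMap.prod_apply, ContinuousLinearMap.coe_fst', Prod.fst_zero] at h1
    subst h1
    simp only [ContinuousLinearMap.prod_apply, Prod.snd_zero] at h2
    rw [hinj w h2]
    rfl
  let L : (E × F) ≃L[ℝ] E × F :=
    LinearEquiv.toContinuousLinearEquiv
      (LinearEquiv.ofInjectiveEndo ((ContinuousLinearMap.fst ℝ E F).prod (fderiv ℝ N p)).toLinearMap hinj')
  refine ⟨L, ?_⟩
  have hcoe : (L : E × F →L[ℝ] E × F) = (ContinuousLinearMap.fst ℝ E F).prod (fderiv ℝ N p) :=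
    ContinuousLinearMap.ext fun v => rfl
  rw [hcoe]
  exact hd

end Graph

/-! ### §3 The stage map is a local diffeomorphism -/

section Stage

variable {E : Type*} [NormedAddCommGroup E] [NormedSpace ℝ E] [FiniteDimensional ℝ E]
variable {F : Type*} [NormedAddCommGroup F] [InnerProductSpace ℝ F] [FiniteDimensional ℝ F]
variable {r ρ : ℝ} {T : E × F → E} {N : E × F → F} {Ψ : ℝ → E × F → F} {lam : ℝ → ℝ}
  {V : Set E} {p : E × F}

/-- **The tube stage map has invertible derivative at every point of `V × B(0, r)`.**
Hypotheses (all pointwise; `q` ranges over `E × F` with `q.1 ∈ V`):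
* smoothness as in `contDiffAt_tubeStageMap`;
* `N`: fibre derivative injective on the shell `r/4 ≤ ‖q.2‖ ≤ r`; source-form Euler defect
  `K₀`-smaller than the radius on `r/4 ≤ ‖q.2‖ ≤ r/2`
  (`DN(q)(0,u) = DN(q)(0,q.2) − N q ⟹ K₀‖u‖ < ‖q.2‖`), where `K₀ ≥ 1` bounds the pacing
  exponent (`exists_stageExponentConst`); radially transversal on `‖q.2‖ = r/4`
  (`DN(q)(0,v) = N q ⟹ ⟪v, q.2⟫ > 0`); `0 < ρ ≤ ‖linkField N (r/4) q‖` for `q.2 ≠ 0`;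
* flatten coupling on `5r/8 ≤ ‖q.2‖ ≤ r`: kernel-graph slope `K`, `‖D_xT − I‖ ≤ δ`, `‖D_yT‖ ≤ C`,
  `‖T q − q.1‖ ≤ D`, `δ + (C + (C₁/r) D) K < 1` where `|η_fl'| ≤ C₁/r`
  (`exists_deriv_flattenCutoff_bound`);
* the unit family: `‖Ψ‖ = 1` and nondegenerate angular derivative off the zero section; the
  core map `R` is onto.
[cite: CampbellDonofrioVitek2026, Lemma 3.2] -/
theorem exists_hasFDerivAt_equiv_tubeStageMap (hr : 0 < r) (hV : IsOpen V)
    -- smoothness data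
    (hN : ∀ q : E × F, q.1 ∈ V → r / 4 ≤ ‖q.2‖ → ‖q.2‖ ≤ r → ContDiffAt ℝ ∞ N q)
    (hT : ∀ q : E × F, q.1 ∈ V → 5 * r / 8 ≤ ‖q.2‖ → ‖q.2‖ ≤ r → ContDiffAt ℝ ∞ T q)
    (hN0 : ∀ q : E × F, q.1 ∈ V → ‖q.2‖ = r / 4 → N q ≠ 0)
    (hΨ : ∀ s : ℝ, ∀ q : E × F, q ∈ radialDomain V → ContDiffAt ℝ ∞ (uncurry Ψ) (s, q))
    (hΨ2 : ∀ s : ℝ, 2 ≤ s → ∀ q : E × F, q ∈ radialDomain V →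
      Ψ s q = ‖linkField N (r / 4) q‖⁻¹ • linkField N (r / 4) q)
    {R : F →ₗᵢ[ℝ] F} (hRs : Surjective R) {t₀ : ℝ} (ht₀ : 0 < t₀)
    (hΨ0 : ∀ q : E × F, q ∈ radialDomain V → Ψ 0 q = R (‖q.2‖⁻¹ • q.2))
    (hlam : ∀ t : ℝ, 0 < t → ContDiffAt ℝ ∞ lam t) (hlam2 : ∀ t, 3 * r / 32 ≤ t → lam t = 2)
    (hlam0 : ∀ t ≤ t₀, lam t = 0)
    -- nondegeneracy data of `N`
    (hNinj : ∀ q : E × F, q.1 ∈ V → r / 4 ≤ ‖q.2‖ → ‖q.2‖ ≤ r →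
      ∀ w : F, fderiv ℝ N q (0, w) = 0 → w = 0)
    {K₀ : ℝ} (hK₀1 : 1 ≤ K₀)
    (hK₀ : ∀ t : ℝ, 0 < t → t ≤ r / 2 → |1 - t * deriv (stagePacing r) t / stagePacing r t| ≤ K₀)
    (hdef : ∀ q : E × F, q.1 ∈ V → r / 4 ≤ ‖q.2‖ → ‖q.2‖ ≤ r / 2 →
      ∀ u : F, fderiv ℝ N q (0, u) = fderiv ℝ N q (0, q.2) - N q → K₀ * ‖u‖ < ‖q.2‖)
    (htr : ∀ q : E × F, q.1 ∈ V → ‖q.2‖ = r / 4 →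
      ∀ v : F, fderiv ℝ N q (0, v) = N q → 0 < ⟪v, q.2⟫)
    (hρ : 0 < ρ) (hρV : ∀ q : E × F, q.1 ∈ V → q.2 ≠ 0 → ρ ≤ ‖linkField N (r / 4) q‖)
    -- flatten coupling
    {C₁ : ℝ} (hC₁ : ∀ t : ℝ, |deriv (flattenCutoff r) t| ≤ C₁ / r)
    (hfl : ∀ q : E × F, q.1 ∈ V → 5 * r / 8 ≤ ‖q.2‖ → ‖q.2‖ ≤ r →
      ∃ K δ C D : ℝ, 0 ≤ C ∧ 0 ≤ K ∧ 0 ≤ D ∧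
        (∀ (v : E) (w : F), fderiv ℝ N q (v, w) = 0 → ‖w‖ ≤ K * ‖v‖) ∧
        (∀ v : E, ‖fderiv ℝ T q (v, 0) - v‖ ≤ δ * ‖v‖) ∧
        (∀ w : F, ‖fderiv ℝ T q (0, w)‖ ≤ C * ‖w‖) ∧ ‖T q - q.1‖ ≤ D ∧
        δ + (C + C₁ / r * D) * K < 1)
    -- unit family
    (hunit : ∀ s : ℝ, ∀ q : E × F, q ∈ radialDomain V → ‖Ψ s q‖ = 1)
    (hker : ∀ s : ℝ, ∀ q : E × F, q ∈ radialDomain V → ∀ w : F, ⟪q.2, w⟫ = 0 →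
      fderiv ℝ (uncurry Ψ) (s, q) (0, ((0 : E), w)) = 0 → w = 0)
    (hp1 : p.1 ∈ V) (hpr : ‖p.2‖ < r) :
    ∃ L : (E × F) ≃L[ℝ] E × F,
      HasFDerivAt (tubeStageMap r ρ T N Ψ lam) (L : E × F →L[ℝ] E × F) p := by
  -- elementary facts
  have hVF : ∀ q : E × F, q.1 ∈ V → q.2 ≠ 0 → linkField N (r / 4) q ≠ 0 := fun q hq1 hq =>
    linkField_ne_zero hr hN0 hq1 hq
  have hNlink : ∀ q : E × F, q.1 ∈ V → q.2 ≠ 0 → ContDiffAt ℝ ∞ N (linkPoint (r / 4) q) := by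
    intro q hq1 hq
    refine hN _ hq1 ?_ ?_ <;> rw [norm_linkPoint_snd hq (by linarith)] ; linarith
  -- transport of an invertible derivative along local agreement
  have transport : ∀ {g : E × F → E × F}, tubeStageMap r ρ T N Ψ lam =ᶠ[𝓝 p] g →
      (∃ L : (E × F) ≃L[ℝ] E × F, HasFDerivAt g (L : E × F →L[ℝ] E × F) p) →
      ∃ L : (E × F) ≃L[ℝ] E × F,
        HasFDerivAt (tubeStageMap r ρ T N Ψ lam) (L : E × F →L[ℝ] E × F) p := by
    intro g hev ⟨L, hL⟩
    exact ⟨L, hL.congr_of_eventuallyEq hev⟩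
  set t : ℝ := ‖p.2‖ with ht
  -- (1) radial zone `t ≤ 3r/32`
  rcases le_or_gt t (3 * r / 32) with h332 | h332
  · refine transport (tubeStageMap_eventuallyEq_radial hr (by linarith)) ?_
    rcases lt_or_ge t t₀ with h0 | h0
    · exact exists_hasFDerivAt_equiv_radialStageMap_core hV hρ.ne' hRs hlam0 hΨ0 hp1 h0
    · have hp : p.2 ≠ 0 := by
        intro h; rw [ht, h, norm_zero] at h0; linarith
      refine exists_hasFDerivAt_equiv_radialStageMap hp hρ.ne' (hΨ _ p ⟨hp1, hp⟩) ?_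
        (hlam t (norm_pos_iff.2 hp)) (fun w hw h0' => hker _ p ⟨hp1, hp⟩ w hw h0')
      -- `‖Ψ‖ = 1` near `(λ t, p)`
      have ho : IsOpen {q : ℝ × (E × F) | q.2 ∈ radialDomain V} :=
        (isOpen_radialDomain hV).preimage continuous_snd
      filter_upwards [ho.mem_nhds (show (lam ‖p.2‖, p).2 ∈ radialDomain V from ⟨hp1, hp⟩)] with q hq
      exact hunit q.1 q.2 hq
  have hp : p.2 ≠ 0 := by
    intro h; rw [ht, h, norm_zero] at h332; linarith
  -- (2) round zone and round-cone overlap `3r/32 < t < r/4` (the rounded formula throughout)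
  rcases lt_or_ge t (r / 4) with h4 | h4
  · have hev : tubeStageMap r ρ T N Ψ lam =ᶠ[𝓝 p] roundStageMap N (r / 4) ρ (roundCutoff r) := by
      rcases lt_or_ge t (5 * r / 32) with h532 | h532
      · -- on the overlap both are the round cone
        have h1 := tubeStageMap_eventuallyEq_roundCone (ρ := ρ) (T := T) hr hV hlam2 hΨ2 hp1 h332 h532
        have h2 : roundStageMap N (r / 4) ρ (roundCutoff r) =ᶠ[𝓝 p]
            fun q => (q.1, (ρ * ‖q.2‖) • (‖linkField N (r / 4) q‖⁻¹ • linkField N (r / 4) q)) := by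
          filter_upwards [(isOpen_lt (continuous_norm.comp continuous_snd) continuous_const).mem_nhds
            h532] with q hq
          rw [roundStageMap, roundMap_of_eta_eq_zero (roundCutoff_of_le hr (le_of_lt hq))]
        exact h1.trans h2.symm
      · exact tubeStageMap_eventuallyEq_round hr (by linarith) h4
    refine transport hev ?_
    have hq2 : ‖(linkPoint (r / 4) p).2‖ = r / 4 := norm_linkPoint_snd hp (by linarith)
    refine exists_hasFDerivAt_equiv_roundStageMap hp (by linarith) (hNlink p hp1 hp) (hVF p hp1 hp)
      (contDiff_roundCutoff r).contDiffAt (roundCutoff_mem_Icc r t) (deriv_roundCutoff_nonneg hr t)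
      hρ (hρV p hp1 hp)
      (fun u hu => hNinj (linkPoint (r / 4) p) hp1 (by rw [hq2]) (by rw [hq2]; linarith) u hu) ?_
    intro v hv
    have h := htr (linkPoint (r / 4) p) hp1 hq2 v hv
    rw [linkPoint_snd_eq, inner_smul_right] at h
    exact (mul_pos_iff_of_pos_left (by linarith : (0 : ℝ) < r / 4)).1 h
  -- (3) cone-ify zone and exact-cone overlap `r/4 ≤ t < r/2` (the cone-ified formula throughout)
  rcases lt_or_ge t (r / 2) with h2 | h2
  · have hev : tubeStageMap r ρ T N Ψ lam =ᶠ[𝓝 p] coneifyStageMap N (stagePacing r) := by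
      rcases lt_or_ge t (5 * r / 16) with h516 | h516
      · have h1 := tubeStageMap_eventuallyEq_cone (ρ := ρ) (T := T) (Ψ := Ψ) (lam := lam) (N := N) hr
          (show 7 * r / 32 < ‖p.2‖ by linarith) h516
        have h2' : coneifyStageMap N (stagePacing r) =ᶠ[𝓝 p]
            fun q => (q.1, ‖q.2‖ • linkField N (r / 4) q) := by
          filter_upwards [(isOpen_lt (continuous_norm.comp continuous_snd) continuous_const).mem_nhds
            h516] with q hq
          rw [coneifyStageMap, coneifyMap_of_eq_const (stagePacing_of_le hr (le_of_lt hq))]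
          rfl
        exact h1.trans h2'.symm
      · exact tubeStageMap_eventuallyEq_coneify (show r / 4 < ‖p.2‖ by linarith) h2
    refine transport hev ?_
    have hμpos := stagePacing_pos hr h4
    have hμI := stagePacing_mem_Icc (r := r) h4
    have hqn : ‖(coneifyPoint (stagePacing r) p).2‖ = stagePacing r t := norm_coneifyPoint_snd hp hμpos.le
    have hq₁ : r / 4 ≤ ‖(coneifyPoint (stagePacing r) p).2‖ := by rw [hqn]; exact hμI.1
    have hq₂ : ‖(coneifyPoint (stagePacing r) p).2‖ ≤ r / 2 := by rw [hqn]; linarith [hμI.2]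
    exact exists_hasFDerivAt_equiv_coneifyStageMap hp (hN _ hp1 hq₁ (by linarith))
      (contDiff_stagePacing r).contDiffAt hμpos (hNinj _ hp1 hq₁ (by linarith))
      (lt_of_lt_of_le one_pos hK₀1) (hdef _ hp1 hq₁ hq₂) (hK₀ t (norm_pos_iff.2 hp) h2.le)
  -- (4) graph overlap `r/2 ≤ t < 5r/8`
  rcases lt_or_ge t (5 * r / 8) with h58 | h58
  · refine transport (tubeStageMap_eventuallyEq_graph hr (by linarith) h58) ?_
    exact exists_hasFDerivAt_equiv_graph (hN p hp1 (by linarith) hpr.le)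
      (hNinj p hp1 (by linarith) hpr.le)
  -- (5) flatten zone `5r/8 ≤ t < r`
  · refine transport (tubeStageMap_eventuallyEq_flatten (by linarith)) ?_
    obtain ⟨K, δ, C, D, hC, hK, hD0, hkerN, hTx, hTy, hD, hsmall⟩ := hfl p hp1 h58 hpr.le
    refine exists_hasFDerivAt_equiv_flattenStageMap hp (hT p hp1 h58 hpr.le)
      (hN p hp1 (by linarith) hpr.le) (contDiff_flattenCutoff r).contDiffAt hC hkerN hTx hTy hD
      (abs_rampCutoff_le_one _ _ _) ?_
    -- `|η'| ≤ C₁ / r`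
    have h1 : (C + |deriv (flattenCutoff r) t| * D) * K ≤ (C + C₁ / r * D) * K := by
      apply mul_le_mul_of_nonneg_right _ hK
      have := mul_le_mul_of_nonneg_right (hC₁ t) hD0
      linarith
    exact lt_of_le_of_lt (by linarith) hsmall

end Stage

end Literature.Topology.FourManifolds
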